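import Summits.QuantumFields.QCD.Theorems.HeatSlicedQuarksRobustYangMillsHandoverSplit
import Summits.QuantumFields.QCD.Theorems.RobustYangMillsHandover.Negative.GapClauses

/-!
# `RobustYangMillsHandover` — strategy census s7 (independent), kernel-checked companion

Crux `stmt-QuantumFields-8892`: `RobustYangMillsHandover := ContinuumQCDExists → QCD` (route
`HeatSlicedQuarks`, slot `h5` of `closes`).  This file records, sorry-free and importing only landed
`Theorems/` modules, the four facts the census `STRATEGY-CENSUS-s7.md` leans on:

* §1 **slot analysis** — the crux is the WEAKEST proposition that can occupy slot `h5`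
  (`filler_iff`): no strictly weaker intermediate replaces it while the antecedent X₀ is kept; given X₀
  it is the summit conjunct (`crux_iff_qcd_of_X0`), and refuting it means proving X₀ (`not_crux_iff`).
* §2 **the X₀-free lattice residue** — the conclusion demands of ONE regularisation a pure-lattice
  infrared profile (`LatticeIRProfile`: asymptotic-freedom scaling, physical branch, chiral pin, and a
  volume-uniform lattice gap at EVERY positive mass tuple) that mentions no OS data at all
  (`crux_imp_latticeResidue`); X₀ speaks only of the convergence of smeared `n`-point functions.
* §3 **genericity of the light-existence residue** — if X₀'s regularisation is uniformly gapped at every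
  positive tuple (a UV witness parked above the chiral point), every chiral `m_crit`-shift of it has a
  NEGATIVE pin (`pin_neg_of_uniformGap_pos`), so the completed conjunct reads the original schemes at
  all-negative offsets (`shift_reads_negative_offsets`) — continuum data X₀ does not contain.
* §4 **the lattice/continuum split** — the best typed decomposition this seat could produce,
  `LatticePinProfile → DataAbovePin → GapTransferAlong → RobustYangMillsHandover`, assembly PROVED
  (`RobustYangMillsHandover_of_LET`); the census explains why pieces Λ and E stay summit-class.

Pure logic over the tree's definitions; nothing here asserts a Theses decl.
-/

namespace Summit.QuantumFields.QCD.Cruxes.RobustYangMillsHandover.CensusS7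

open Summit.QuantumFields.QCD.Theses.HeatSlicedQuarks
open Summit.QuantumFields.QCD.Theorems.RobustYangMillsHandover
open Literature.MathematicalPhysics.QuantumFieldTheory
open Filter

variable {Nf : ℕ}

/-! ## §1 Slot analysis: the crux is the weakest filler of `h5` -/

/-- **Weakest filler.** A proposition `X'` closes the route in slot `h5` (from X₀ and `X'` one gets
`QCD`) iff `X'` implies the crux.  Hence no STRICTLY weaker statement can replace the crux while the
antecedent `ContinuumQCDExists` is kept. [folklore] -/
theorem filler_iff (X' : Prop) :
    (ContinuumQCDExists → X' → _root_.QCD) ↔ (X' → RobustYangMillsHandover) :=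
  ⟨fun h hx hX => h hX hx, fun h hX hx => h hx hX⟩

/-- `QCD` itself fills the slot: the crux is sandwiched `QCD → crux`. [folklore] -/
theorem crux_of_qcd : _root_.QCD → RobustYangMillsHandover := fun q _ => q

/-- Given the antecedent, the crux IS the summit conjunct. [folklore] -/
theorem crux_iff_qcd_of_X0 (hX : ContinuumQCDExists) : RobustYangMillsHandover ↔ _root_.QCD :=
  ⟨fun h => h hX, fun q _ => q⟩

/-- Refuting the crux is exactly proving X₀ and refuting `QCD` (negation has no cheaper target).
[folklore] -/
theorem not_crux_iff : ¬ RobustYangMillsHandover ↔ ContinuumQCDExists ∧ ¬ _root_.QCD :=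
  Negative.not_handover_iff

/-! ## §2 The X₀-free lattice residue of the conclusion -/

variable (Nf) in
/-- **The pure-lattice infrared profile** the conjunct `QCDOf N_f` demands of ONE regularisation:
mass scaling, chiral pin, and at every positive mass tuple asymptotic-freedom scaling of the bare
coupling, the physical branch of the bare Wilson masses, and a volume-uniform lattice mass gap.  No
Osterwalder–Schrader data occur. [folklore] -/
def LatticeIRProfile : Prop :=
  ∃ reg : QCDRegularisation Nf, reg.HasMassScaling ∧ reg.IsChiralAtZero ∧
    ∀ m : Fin Nf → ℝ, (∀ f, 0 < m f) →
      (reg.scheme m 0 0).HasAsymptoticScaling ∧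
        (∀ f : Fin Nf, ∀ᶠ k in atTop, -1 < (reg.scheme m 0 0).mq f k) ∧
          ∃ Δ > 0, (reg.scheme m 0 0).HasLatticeMassGap Δ

/-- The conjunct implies its lattice residue (the OS data are simply forgotten; the scaling and branch
clauses of `IsQCDAlong` and the lattice gap clause read only `β, a, L, mq`). [folklore] -/
theorem latticeIRProfile_of_qcdOf (h : QCDOf Nf) : LatticeIRProfile Nf := by
  obtain ⟨reg, hMS, hχ, hall⟩ := h
  refine ⟨reg, hMS, hχ, fun m hm => ?_⟩
  obtain ⟨z, shift, T, hA, -, -, -, Δ, hΔ, -, hL⟩ := hall m hm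
  exact ⟨hA.1, hA.2.1, Δ, hΔ, (Negative.hasLatticeMassGap_species_irrel reg m z shift Δ).mp hL⟩

/-- **What the crux must produce that X₀ cannot contain**: from X₀ (convergence statements only) the
pure-lattice infrared profile for `N_f = 2` and `N_f = 3`. [folklore] -/
theorem crux_imp_latticeResidue (h : RobustYangMillsHandover) (hX : ContinuumQCDExists) :
    LatticeIRProfile 2 ∧ LatticeIRProfile 3 :=
  ⟨latticeIRProfile_of_qcdOf (h hX).1, latticeIRProfile_of_qcdOf (h hX).2⟩

/-- The residue has NO uniform rate (chirality) yet is gapped at every positive tuple: both the heavy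
regime (weak-coupling lattice gap with decoupling quarks) and the light regime (rates `→ 0`) are inside.
[folklore] -/
theorem latticeIRProfile_noUniformRate (h : LatticeIRProfile Nf) :
    ∃ reg : QCDRegularisation Nf,
      (∀ m : Fin Nf → ℝ, (∀ f, 0 < m f) → ∃ Δ > 0, (reg.scheme m 0 0).HasLatticeMassGap Δ) ∧
        ¬ ∃ ε > (0 : ℝ), ∀ m : Fin Nf → ℝ, (∀ f, 0 < m f) → (reg.scheme m 0 0).HasLatticeMassGap ε := by
  obtain ⟨reg, -, hχ, hall⟩ := h
  refine ⟨reg, fun m hm => (hall m hm).2.2, ?_⟩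
  rintro ⟨ε, hε, hgap⟩
  exact Negative.not_isChiralAtZero_of_uniformLatticeGap reg hε hgap hχ

/-! ## §3 The light-existence residue is generic -/

/-- The `m_crit`-shift of a regularisation by an offset `P` (the only regularisations whose schemes are
X₀'s schemes, hence the only ones for which X₀'s `IsQCDAlong` data can be reused). [folklore] -/
noncomputable def shiftReg (reg : QCDRegularisation Nf) (P : ℝ) : QCDRegularisation Nf :=
  { reg with mcrit := fun k => reg.mcrit k + reg.a k * P / reg.Zm k }

/-- The shifted scheme at `m` is the original scheme at `P + m`. [folklore] -/
theorem shiftReg_scheme (reg : QCDRegularisation Nf) (P : ℝ) (m : Fin Nf → ℝ)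
    (z shift : QCDField Nf → ℕ → ℝ) :
    (shiftReg reg P).scheme m z shift = reg.scheme (fun f => P + m f) z shift := by
  simp only [shiftReg, QCDRegularisation.scheme, QCDScheme.mk.injEq, true_and, and_true]
  funext f k
  ring

/-- **Negative pin.** If `reg` is uniformly gapped (one rate `ε`) at EVERY positive mass tuple — the
expected shape of a UV witness parked strictly above the chiral point — then any chiral `m_crit`-shift
of it has a strictly NEGATIVE offset. [folklore] -/
theorem pin_neg_of_uniformGap_pos (reg : QCDRegularisation Nf) {ε : ℝ} (hε : 0 < ε)
    (h : ∀ m : Fin Nf → ℝ, (∀ f, 0 < m f) → (reg.scheme m 0 0).HasLatticeMassGap ε) (P : ℝ)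
    (hχ : (shiftReg reg P).IsChiralAtZero) : P < 0 := by
  by_contra hP
  push Not at hP
  exact Negative.not_isChiralAtZero_mcrit_shift_of_uniformGapAbove reg P hε
    (fun m hm => h m fun f => lt_of_le_of_lt hP (hm f)) hχ

/-- **… so the completion reads below zero.** With a negative pin there is a POSITIVE mass tuple of the
shifted regularisation whose scheme is the original scheme at an all-NEGATIVE offset tuple: the
conjunct's `IsQCDAlong` clause there is continuum existence data that X₀ (positive offsets of `reg`
only) does not provide. [folklore] -/
theorem shift_reads_negative_offsets (reg : QCDRegularisation Nf) {P : ℝ} (hP : P < 0) :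
    ∃ m : Fin Nf → ℝ, (∀ f, 0 < m f) ∧ (∀ f, P + m f < 0) ∧
      ∀ z shift : QCDField Nf → ℕ → ℝ,
        (shiftReg reg P).scheme m z shift = reg.scheme (fun f => P + m f) z shift :=
  ⟨fun _ => -P / 2, fun _ => by linarith, fun _ => by linarith,
    fun z shift => shiftReg_scheme reg P _ z shift⟩

/-- The two facts combined, in the form the census quotes. [folklore] -/
theorem generic_completion_needs_data_below_zero (reg : QCDRegularisation Nf) {ε : ℝ} (hε : 0 < ε)
    (h : ∀ m : Fin Nf → ℝ, (∀ f, 0 < m f) → (reg.scheme m 0 0).HasLatticeMassGap ε) (P : ℝ)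
    (hχ : (shiftReg reg P).IsChiralAtZero) :
    ∃ m : Fin Nf → ℝ, (∀ f, 0 < m f) ∧ (∀ f, P + m f < 0) ∧
      ∀ z shift : QCDField Nf → ℕ → ℝ,
        (shiftReg reg P).scheme m z shift = reg.scheme (fun f => P + m f) z shift :=
  shift_reads_negative_offsets reg (pin_neg_of_uniformGap_pos reg hε h P hχ)

/-! ## §4 The lattice/continuum split (best typed decomposition of this seat; assembly proved) -/

/-- X₀'s honest data for one regularisation (the per-`reg` body of `ContinuumQCDExists`). [folklore] -/
def HonestData (reg : QCDRegularisation Nf) : Prop :=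
  ∀ m : Fin Nf → ℝ, (∀ f, 0 < m f) →
    ∃ (z shift : QCDField Nf → ℕ → ℝ) (T : OSData (QCDField Nf) 4),
      IsQCDAlong (reg.scheme m z shift) T ∧ T.IsNontrivial QCDField.glue ∧
        T.IsNonGaussian QCDField.glue ∧ ∀ f g : Fin Nf, f ≠ g → T.IsNontrivial (QCDField.pseudoRe f g)

/-- Piece Λ (**pure lattice**): every X₀-honest regularisation has a PIN — an offset above which lattice
QCD is gapped at every tuple and just above which there is no uniform rate.  Contains the weak-coupling,
volume-uniform lattice gap of `SU(3)` + Wilson quarks at every mass above the pin (heavy regime = the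
sibling conjunct's lattice gap plus decoupling) AND the Goldstone regime at the pin. [folklore] -/
def LatticePinProfile : Prop :=
  ∀ Nf : ℕ, Nf = 2 ∨ Nf = 3 → ∀ reg : QCDRegularisation Nf, reg.HasMassScaling → HonestData reg →
    ∃ P : ℝ, (∀ t : Fin Nf → ℝ, (∀ f, P < t f) → ∃ Δ > 0, (reg.scheme t 0 0).HasLatticeMassGap Δ) ∧
      ∀ ε > (0 : ℝ), ∃ t : Fin Nf → ℝ, (∀ f, P < t f) ∧ ¬ (reg.scheme t 0 0).HasLatticeMassGap ε

/-- Piece E (**continuum data above the pin**): honest OS data at every tuple above any pin of Λ's shape.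
For tuples with all components positive this is X₀ itself; its content is the slab `(P, 0]` — light-quark
continuum existence, generic by §3. [folklore] -/
def DataAbovePin : Prop :=
  ∀ Nf : ℕ, Nf = 2 ∨ Nf = 3 → ∀ reg : QCDRegularisation Nf, reg.HasMassScaling → HonestData reg →
    ∀ P : ℝ, (∀ t : Fin Nf → ℝ, (∀ f, P < t f) → ∃ Δ > 0, (reg.scheme t 0 0).HasLatticeMassGap Δ) →
      ∀ t : Fin Nf → ℝ, (∀ f, P < t f) →
        ∃ (z shift : QCDField Nf → ℕ → ℝ) (T : OSData (QCDField Nf) 4),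
          IsQCDAlong (reg.scheme t z shift) T ∧ T.IsNontrivial QCDField.glue ∧
            T.IsNonGaussian QCDField.glue ∧ ∀ f g : Fin Nf, f ≠ g → T.IsNontrivial (QCDField.pseudoRe f g)

/-- Piece T (**gap transfer**, the shape of item 8923): a lattice gap along a scheme with a continuum
limit gives a gap of the limit. The only sub-summit piece. [folklore] -/
def GapTransferAlong : Prop :=
  ∀ Nf : ℕ, ∀ (sch : QCDScheme Nf) (T : OSData (QCDField Nf) 4) (Δ : ℝ),
    IsQCDAlong sch T → 0 < Δ → sch.HasLatticeMassGap Δ → ∃ Δ' > 0, Δ' ≤ Δ ∧ T.HasMassGap Δ'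

/-- **Assembly of the split, proved**: Λ → E → T → crux.  X₀ is consumed once (to get the honest
regularisation); the witness is its `m_crit`-shift by Λ's pin (`Split.qcdOf_of_pin_body`). [folklore] -/
theorem RobustYangMillsHandover_of_LET (hΛ : LatticePinProfile) (hE : DataAbovePin)
    (hT : GapTransferAlong) : RobustYangMillsHandover := by
  intro hX
  have key : ∀ Nf : ℕ, Nf = 2 ∨ Nf = 3 → QCDOf Nf := by
    intro Nf hNf
    obtain ⟨reg, hMS, hdata⟩ := hX Nf hNf
    have hH : HonestData reg := hdata
    obtain ⟨P, hgap, hχ⟩ := hΛ Nf hNf reg hMS hH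
    refine Split.qcdOf_of_pin_body reg hMS P hχ fun t ht => ?_
    obtain ⟨z, shift, T, hA, hN, hG, hPs⟩ := hE Nf hNf reg hMS hH P hgap t ht
    obtain ⟨Δ, hΔ, hL⟩ := hgap t ht
    have hL' : (reg.scheme t z shift).HasLatticeMassGap Δ :=
      (Negative.hasLatticeMassGap_species_irrel reg t z shift Δ).mpr hL
    obtain ⟨Δ', hΔ', hle, hTg⟩ := hT Nf (reg.scheme t z shift) T Δ hA hΔ hL'
    exact ⟨z, shift, T, hA, hN, hG, hPs, Δ', hΔ', hTg, Negative.hasLatticeMassGap_anti _ hle hL'⟩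
  exact ⟨key 2 (Or.inl rfl), key 3 (Or.inr rfl)⟩

/-- Piece Λ already carries the whole X₀-free lattice residue of §2 for X₀'s own regularisations, up to
the shift: from Λ and X₀ alone one gets a chirally pinned, everywhere-gapped lattice profile (no OS data
needed) — i.e. Λ is where the sibling conjunct's open core sits. [folklore] -/
theorem latticeProfile_of_Λ (hΛ : LatticePinProfile) (hX : ContinuumQCDExists) {Nf : ℕ}
    (hNf : Nf = 2 ∨ Nf = 3) :
    ∃ reg : QCDRegularisation Nf, reg.HasMassScaling ∧ reg.IsChiralAtZero ∧
      ∀ m : Fin Nf → ℝ, (∀ f, 0 < m f) → ∃ Δ > 0, (reg.scheme m 0 0).HasLatticeMassGap Δ := by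
  obtain ⟨reg, hMS, hdata⟩ := hX Nf hNf
  obtain ⟨P, hgap, hχ⟩ := hΛ Nf hNf reg hMS hdata
  refine ⟨shiftReg reg P, (Negative.hasMassScaling_mcrit_shift_iff reg P).mpr hMS, ?_, ?_⟩
  · intro ε hε
    obtain ⟨t, ht, hng⟩ := hχ ε hε
    refine ⟨fun f => t f - P, fun f => by linarith [ht f], ?_⟩
    rw [shiftReg_scheme]
    have ht' : (fun f => P + (t f - P)) = t := funext fun f => by ring
    rwa [ht']
  · intro m hm
    obtain ⟨Δ, hΔ, hL⟩ := hgap (fun f => P + m f) fun f => by linarith [hm f]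
    exact ⟨Δ, hΔ, by rwa [shiftReg_scheme]⟩

end Summit.QuantumFields.QCD.Cruxes.RobustYangMillsHandover.CensusS7
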